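import Literature.MathematicalPhysics.QuantumFieldTheory.Balaban1983to89.B9Cor35GAtCubeLettersFirstOrder
import Literature.MathematicalPhysics.QuantumFieldTheory.Balaban1983to89.B9Ineq375GradDivBoundsY
import Literature.MathematicalPhysics.QuantumFieldTheory.Balaban1983to89.B9Cor36GCubeWindows
import Literature.MathematicalPhysics.QuantumFieldTheory.Balaban1983to89.B9Cor35POneAtCubeLetters
import Literature.MathematicalPhysics.QuantumFieldTheory.Balaban1983to89.B9Eq376ProjPieceDictY
import Literature.MathematicalPhysics.QuantumFieldTheory.Balaban1983to89.B9Cor36CinvCubeAtLocCfg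

/-!
# `Balaban1983to89.B9Cor36GCubeAtLocCfg` — COROLLARY 3.6 p. 408 FOR THE BOND-SECTOR CUBE LETTER `G_□ = Δ_{a,□}⁻¹` AT THE LOCALISED (3.35)∕(3.37) FIELD `Ṽ_□ = e^{iηχ̃_□A}`:
# `Δ_{a,□}(Ṽ_□)` IS A UNIT, the two (3.86) resolvent laws, and the LEFT-ENTRY transfer of Theorem 3.3's (3.42) from `G_□(1)` to `G_□(Ṽ_□)`, uniformly in the member and
# the cover cube — G-F5′ `cor35_G_cube_of_pieces₂` with EVERY input slot plugged from the (3.35) cube datum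
# (sub-row G-B9-LETTERS, module M5.1b-G «Cor 3.5∕3.6 for the bond-sector cube letter G_□», FILE G-F7 = the instantiation)

T. Bałaban, *Propagators for lattice gauge theories in a background field*, Commun. Math. Phys. **99** (1985) 389–434
[`Balaban1985BackgroundPropagators`, "B9"]; [4] = Commun. Math. Phys. **96** (1984) 223–250 [`Balaban1984PropagatorsII`].

statement-level skeleton of published theorems with citation tags; proofs where landed; nothing here is a claim about the
Yang–Mills mass gap

THE PRINTED LOCUS (verbatim, held `paper:balaban1985-cmp99-background-propagators`, journal page = PDF page + 388; page owner r06).  Cor. 3.6 p. 408 l. 7–14: *«If a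
configuration U satisfies (3.35) with O(1)Mα₀ ≦ a₁, and Ω′₀ ⊂ □ for a cube □ of the class described in this condition, then Theorems 3.1-3.3 hold for the operators G′(U),
(Q′(U)G′²(U)Q′\*(U))⁻¹, G(U) constructed for the sequence {Ω′_j} … Applying the gauge transformation u we get U′ = U^u = e^{iηA} … U′ satisfies (3.37) for the sequence {Ω′_j} with
U = 1 and α₁ = O(1)Mα₀»*; Thm 3.4 p. 400; (3.82)–(3.86) p. 407 (*«V(A) = Δ_a(U) − Δ_a(U′U) … G(U′U) = G(U) + G(U′U)V(A)G(U) (3.86). This way we get all these inequalities for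
the operator G(U′U)»*); (3.69)–(3.77) pp. 404–406 (the pieces of `V(A)`); (3.85) p. 407; Sect. C p. 409 l. 1–5 (`G_□(U)` of the cube sequence); [4] Lemma 2.1 (2.61) p. 234,
(2.51) p. 232.

WHY THIS FILE (cell `lit-balaban`; module M5.1b-G, p38 g43).  G-F5′ (`B9Cor35GAtCubeLettersFirstOrder.cor35_G_cube_of_pieces₂`, p653979) is Theorem 3.4's G-clause for the
cube letter with EVERY analytic input displayed as a hypothesis in one currency (block majorants over `(toB6 (geoCK i □) Rr H, blkBK i □)`): the (3.42) entries of `G_□(1)`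
(`hG`, `hDG`), the Laplacian piece (`hLap`, `hV0`, `hV1`), the projection piece (`hProj`, `hP0`, `hP1`, `hPP`), the averaging piece (`hAv`), (2.61) at two rates, two scale
transfers, and the located smallness `κα₁c₁ < 1`.  THIS FILE plugs every slot with its producer at `V := Ṽ_□ = locCfgY i □ η A`, `parS := parSymY i`: G-F4 `thm33_GK_cube`
(rate weakened), G-F5a `conj_hessY_one_sub_hessY_eq` + bridge II `hasMajorant_V0Y_locCfgY`∕`hasMajorant_V1Y_locCfgY`, G-F5b `hasMajorant_P0Y`∕`hasMajorant_P1Y` at bridge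
II's windows `hW1_locCfgY`∕`hW2_locCfgY`, G-F5c″ `projPieceK_eq_firstOrder_add_projWord` + `hasMajorant_projWord_of_POne` fed by G-F5c′ `cor35_POne_cube` (its nine
readings∕sizes discharged from the datum verbatim as in p21's `cinv_cube_at_locCfg`), bridge II `hasMajorant_avgPieceK_locCfgY`, p33's `exists_h261_geoCK` (ONE exponent at
the rate `δ∕2` serves both (2.61) slots) and `hST_geoCK` (`Λ = L⁴`); the constants are collected into ONE located smallness which the datum's size `s = max(C, C(1+D₁θ))Λ²`
meets below an explicit threshold (`α_W(s) ≦ 60s` for `s ≦ 1∕6`).  Output: `Δ_{a,□}(Ṽ_□)` is a unit, the two (3.86) laws, and the left-entry transfer at `(2c₁, (1 − 9∕5000)·δ∕2)`.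

WHAT THIS FILE PROVES (THEOREMS; 0 `def … : Prop`, 0 sorry, 0 def).
* §1 bookkeeping: `self_le_alphaW`, `alphaW_le_sixty_mul` (`α_W(s) ≦ 60s` on `[0, 1∕6]`), `kappaAv_le_of_le_one`, `kernel_const_mono`.
* §2 ★★★ `cor36_G_cube_at_locCfg'` (v1.1, 2026-08-28 gen 44: the same conclusion PLUS, with ONE explicit constant `A_G ≧ 0` of Theorem 3.3 at `U = 1`, the three
  flat entries `G_□(1) ≺ A_G(Lⁿη)²e^{−ρd}`, `∇_ν·G_□(1) ≺ A_G·Lⁿη·e^{−ρd}`, `Δ·G_□(1) ≺ A_G·e^{−ρd}` AT THE TRANSFER RATE `ρ`, and the three TRANSFERRED left entries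
  `G_□(Ṽ_□) ≺ A_Gθ(Lⁿη)²e^{−(1−9∕5000)ρd}`, `∇_ν·G_□(Ṽ_□) ≺ A_Gθ·Lⁿη·e^{−(1−9∕5000)ρd}`, `Δ·G_□(Ṽ_□) ≺ A_Gθ·e^{−(1−9∕5000)ρd}` — the flat-derivative (3.42)₁,₂,₄ entries of
  `G_□(Ṽ_□)` that G-F6 turns into the covariant-derivative entries; v1.0 exported only the transfer CLAUSE, whose rate `ρ` could not be compared with Theorem 3.3's
  rate from outside the proof); ★★★ `cor36_G_cube_at_locCfg` (the v1.0 statement VERBATIM, now a projection of the primed theorem).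

HONEST SCOPE.  Assembly over landed modules; DISPLAYED: the (3.35) cube datum (`hC … hdA`, Hermitian type `hAu`), member thresholds, `s ≦ a₁`; `parS = parSymY i`, `parB = parBY i`.
NOT here: the RIGHT entries `G_□(Ṽ_□)·∇*` ((3.42)₃; r06 `B9Ineq386RightEntry`, cell GAPS G-B9-02 — needs the right-oriented flat entries of `G_□(1)`, not in G-F4) and the Hölder ∕ L²
entries; the cut∕transported letter's `hE` (G-F6) is the next file.  Count-neutral; no summit ∕ sub-problem statement is proved; nothing continuum ∕ OS ∕ mass-gap ∕ Clay; NOT a node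
discharge; YM mass gap NOT proved by any of this (Track A conditional rung).  No `sorry`, no `axiom`, no `… : Prop` fact, no `instance`, no `notation`.  NEW file; nothing landed
is modified.  Cell `lit-balaban`, seat `lit-balaban-p38` gen 43, 2026-08-28 (v1.1: gen 44, same day — one theorem added, the v1.0 statement kept verbatim); `--supports
stmt-QuantumFields-19200`.  Net new unproved facts: 0.

RELATED IN THE TREE, NOT DUPLICATED (searched 2026-08-28): p33 `B9Cor36GpCubeIsUnit.isUnit_and_localInverse_laws` (the site-sector twin; pattern mirrored), p21
`B9Cor36CinvCubeAtLocCfg.cinv_cube_at_locCfg` (C-letter twin; the nine readings' derivation copied by name), G-F4∕G-F5′∕G-F5a∕G-F5b∕G-F5c′∕G-F5c″∕bridge II (USED BY NAME).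
-/

noncomputable section

namespace Literature.MathematicalPhysics.QuantumFieldTheory.Balaban1983to89.B9Cor36GCubeAtLocCfg

open NormedSpace Complex
open B4PartitionUnity22 (thetaProf D1)
open B6RandomWalk (HasMajorant hasMajorant_mono Ineq261 c1_nonneg delta3 delta3_pos)
open B9Thm34Ext (toB6)
open B9Ineq347 (ScaleTransfer)
open B9Eq352DivFormLetters (conj)
open B9Eq39Adjoint (fluct covD covDstar)
open B9Eq352DivForm (tauB)
open B6KLevelCensusIndexV1 (KIdx kGeo)
open B6Cover236MultiLevelBlocks (cubes)
open B6GlobalChartV1 (PV boxEquiv)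
open B9BackgroundsKLevelV1 (shiftsV1)
open B9Eq360DeltaPrimeAY (AfldY chartA)
open B9Eq360DeltaPrimeACubeY (blkCubeY kFCubeY sFCubeY levCubeY_eq)
open B9CubeLettersOpsL0 (cubeFamY levCubeY GpCubeY)
open B9CubeLettersBondOpsL0 (BlkCubeY qpKc qpsKc QpCubeY QpsCubeY XinvCubeY deltaACubeY)
open B9CubeGeometryInputs (geoCK geoCK_len geoCK_eta geoCK_eta_pos geoCK_len_pos geoCK_len_blkCubeY geoCK_dist_axioms RM1 N1 exists_h261_geoCK hST_geoCK)
open B9Cor36CutoffField337 (cutFldY)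
open B9Cor36CubeCutoffs (SC NearC chiTY locCfgY readings337_locFld scaleLen_levCubeY_bounds)
open B9Eq359CubeKernelsAtOne (Cq Cq_nonneg norm_kFCubeY_parSymY_le norm_sFCubeY_parSymY_le ownLevel_of_blockwise)
open B9Eq357CubeLetters (norm_QpCubeY_prod_sub_apply_le norm_QpsCubeY_prod_sub_apply_le)
open B9Cor35GpCubeInputsAtOne (wK)
open B9Cor35GCubeInputsAtOne (blkBK GK DK LapK GVK VK thm33_GK_cube)
open B9Cor35GAtCubeLetters (kappa385d kappa385d_nonneg lapPieceK projPieceK)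
open B9Cor35GAtCubeLettersFirstOrder (cor35_G_cube_of_pieces₂)
open B9Cor35CinvAtCubeLetters (kernel_rate_mono)
open B9Eq371CoCurlLeibnizY (conj_hessY_one_sub_hessY_eq)
open B9Ineq373HessianPieceBoundsY (cV0 cV1)
open B9Ineq375GradDivBoundsY (cP0 cP1 hasMajorant_P0Y hasMajorant_P1Y)
open B9Cor36GCubeWindows (sRead sRead_nonneg alphaW alphaW_nonneg unitaryLike_locCfgY hW1_locCfgY hW2_locCfgY hasMajorant_V0Y_locCfgY hasMajorant_V1Y_locCfgY
  hasMajorant_avgPieceK_locCfgY)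
open B9Cor35GCubeAvgPiece (avgPieceK kappaAv)
open B9Cor35POneAtCubeLetters (cor35_POne_cube)
open B9Eq376ProjPieceDictY (hasMajorant_projWord_of_POne projPieceK_eq_firstOrder_add_projWord)
open Node00 (SiteY CfgY FBondY SiteParY toKT shiftY parSymY parSymY_one parBY parBY_one)

variable {d ℓ : ℕ} {hd : 1 ≤ d + 1} {hL : Odd (ℓ + 1) ∧ 1 < ℓ + 1} {b₀ b₁ : ℝ}
variable {𝔸 : Type} [NormedRing 𝔸] [NormedAlgebra ℂ 𝔸] [CompleteSpace 𝔸]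
variable {ι : Type} [Fintype ι] (b : Module.Basis ι ℝ 𝔸)

/-! ## §1 Bookkeeping: the size function `α_W`, the averaging constant, kernel monotonicity -/

section Book

/-- `s ≦ α_W(s)` for `s ≧ 0`. [cite: Balaban1985BackgroundPropagators, (3.69) p.404, Cor. 3.6 p.408, bookkeeping] -/
theorem self_le_alphaW {s : ℝ} (hs : 0 ≤ s) : s ≤ alphaW s := by
  unfold alphaW
  have h1 : 1 ≤ Real.exp (6 * s) := Real.one_le_exp (by positivity)
  nlinarith [sq_nonneg s, mul_le_mul_of_nonneg_right h1 (by positivity : (0 : ℝ) ≤ 2 * s + 18 * s ^ 2)]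

/-- `α_W(s) ≦ 60·s` for `0 ≦ s ≦ 1∕6` (`e ≦ 3`, `s² ≦ s`). [cite: Balaban1985BackgroundPropagators, Cor. 3.6 p.408 («O(1)Mα₀ ≦ a₁»), bookkeeping] -/
theorem alphaW_le_sixty_mul {s : ℝ} (hs : 0 ≤ s) (hs6 : s ≤ 1 / 6) : alphaW s ≤ 60 * s := by
  unfold alphaW
  have he : Real.exp (6 * s) ≤ 3 := by
    calc Real.exp (6 * s) ≤ Real.exp 1 := Real.exp_le_exp.2 (by linarith)
      _ ≤ 3 := by have := Real.exp_one_lt_d9; linarith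
  have hsq : s ^ 2 ≤ s := by nlinarith
  have h0 : 0 ≤ 2 * s + 18 * s ^ 2 := by positivity
  calc Real.exp (6 * s) * (2 * s + 18 * s ^ 2) ≤ 3 * (2 * s + 18 * s ^ 2) := mul_le_mul_of_nonneg_right he h0
    _ ≤ 60 * s := by nlinarith

/-- `κ_av(d, L, b₁, α, δ) ≦ α·κ̄_av(d, L, b₁, δ)` for `0 ≦ α ≦ 1`, `κ̄_av = 8(d+2)(d+3)b₁L^{d+1}e^{δ(2L+4)}`. [cite: Balaban1985BackgroundPropagators, (3.83) p.407, bookkeeping] -/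
theorem kappaAv_le_of_le_one (d ℓ : ℕ) {b₁' α δ : ℝ} (hb : 0 ≤ b₁') (hα : 0 ≤ α) (hα1 : α ≤ 1) :
    kappaAv d ℓ b₁' α δ ≤ α * (8 * ((d : ℝ) + 2) * (1 + ((d : ℝ) + 2)) * b₁' * (((ℓ + 1 : ℕ) : ℝ) ^ (d + 1)) * Real.exp (δ * (2 * (ℓ : ℝ) + 6))) := by
  unfold kappaAv
  have h1 : 1 + ((d : ℝ) + 2) * α ≤ 1 + ((d : ℝ) + 2) := by nlinarith
  have h0 : 0 ≤ 8 * (((d : ℝ) + 2) * α) := by positivity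
  have h2 : 0 ≤ b₁' * (((ℓ + 1 : ℕ) : ℝ) ^ (d + 1)) * Real.exp (δ * (2 * (ℓ : ℝ) + 6)) := by positivity
  calc 8 * (((d : ℝ) + 2) * α) * (1 + ((d : ℝ) + 2) * α) * b₁' * (((ℓ + 1 : ℕ) : ℝ) ^ (d + 1)) * Real.exp (δ * (2 * (ℓ : ℝ) + 6))
      = 8 * (((d : ℝ) + 2) * α) * (1 + ((d : ℝ) + 2) * α) * (b₁' * (((ℓ + 1 : ℕ) : ℝ) ^ (d + 1)) * Real.exp (δ * (2 * (ℓ : ℝ) + 6))) := by ring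
    _ ≤ 8 * (((d : ℝ) + 2) * α) * (1 + ((d : ℝ) + 2)) * (b₁' * (((ℓ + 1 : ℕ) : ℝ) ^ (d + 1)) * Real.exp (δ * (2 * (ℓ : ℝ) + 6))) := by gcongr
    _ = α * (8 * ((d : ℝ) + 2) * (1 + ((d : ℝ) + 2)) * b₁' * (((ℓ + 1 : ℕ) : ℝ) ^ (d + 1)) * Real.exp (δ * (2 * (ℓ : ℝ) + 6))) := by ring

variable {G : B9.Geometry}

/-- kernel monotonicity in the constant and the rate: `c·w(a)·e^{−δd} ≦ c′·w(a)·e^{−δ′d}` for `c ≦ c′`, `δ′ ≦ δ`, `w, d ≧ 0`. [cite: Balaban1984PropagatorsII, (2.51) p.232, bookkeeping] -/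
theorem kernel_const_mono (hdnn : ∀ a a' : G.Site, 0 ≤ G.dist a a') {c c' δ δ' : ℝ} (w : G.Site → ℝ) (hw : ∀ a, 0 ≤ w a) (hc : c ≤ c') (hc' : 0 ≤ c') (hδ : δ' ≤ δ)
    (a a' : G.Site) : c * w a * Real.exp (-(δ * G.dist a a')) ≤ c' * w a * Real.exp (-(δ' * G.dist a a')) :=
  mul_le_mul (mul_le_mul_of_nonneg_right hc (hw a)) (Real.exp_le_exp.2 (by nlinarith [hdnn a a'])) (Real.exp_pos _).le (mul_nonneg hc' (hw a))

end Book

/-! ## §2 ★★★ Corollary 3.6 for `G_□` at `Ṽ_□`: every slot of `cor35_G_cube_of_pieces₂` plugged from the (3.35) datum -/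

section Main

set_option maxHeartbeats 2400000 in
/-- ★★★ **COROLLARY 3.6 FOR THE BOND-SECTOR CUBE LETTER `G_□ = Δ_{a,□}⁻¹` AT THE LOCALISED FIELD `Ṽ_□ = e^{iηχ̃_□A}`, UNIFORMLY IN THE MEMBER AND THE COVER CUBE — WITH
THE FLAT AND THE TRANSFERRED LEFT ENTRIES EXPORTED** (v1.1): there are a rate `ρ > 0`, a constant `θ ≧ 0`, member thresholds `M₀, T₀, N₀`, a size threshold `a₁ > 0` and
Theorem 3.3's constant `A_G ≧ 0` — functions of `d, L, b₀, b₁` and the basis datum `M₂` only — such that for every member above the thresholds, every cover cube `□` and every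
vector potential `A` of Hermitian type carrying the (3.35) cube datum `(Q, C, ξ, Λ)` with `max(C, C(1+D₁θ))Λ² ≦ a₁`: `Δ_{a,□}(Ṽ_□)` (transporters `parSymY`, `parBY`) IS A
UNIT, the two (3.86) resolvent laws hold for the realified `G_□(Ṽ_□) = conj b(Δ_{a,□}(Ṽ_□)⁻¹)`, every LEFT (3.42) entry transfers: `X·G_□(1) ≺ B·P(a)·e^{−ρd}` ⟹
`X·G_□(Ṽ_□) ≺ B·θ·P(a)·e^{−(1 − 9∕5000)ρ·d}` over `(toB6 (geoCK i □) Rr H, blkBK i □)`; AND (v1.1) Theorem 3.3's three entries of `G_□(1)` at the rate `ρ`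
(`G_□(1) ≺ A_G(Lⁿη)²e^{−ρd}`, `∇_ν·G_□(1) ≺ A_G·Lⁿη·e^{−ρd}`, `Δ·G_□(1) ≺ A_G·e^{−ρd}`, flat `∇_ν = DK`, `Δ = LapK`) together with their transfers to `G_□(Ṽ_□)`
(`G_□(Ṽ_□) ≺ A_Gθ(Lⁿη)²e^{−(1−9∕5000)ρd}`, `∇_ν·G_□(Ṽ_□) ≺ A_Gθ·Lⁿη·e^{−(1−9∕5000)ρd}`, `Δ·G_□(Ṽ_□) ≺ A_Gθ·1·e^{−(1−9∕5000)ρd}`).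
[cite: Balaban1985BackgroundPropagators, Cor. 3.6 p.408, Thm 3.4 p.400, (3.82)–(3.86) p.407, (3.69)–(3.77) pp.404–406, Cor. 3.5 p.407, Thm 3.3 p.399, (3.42) p.397, p.409 l.1–5; Balaban1984PropagatorsII, Lemma 2.1 (2.61) p.234, (2.51) p.232, Prop. 2.6 (2.136) p.247] -/
theorem cor36_G_cube_at_locCfg' [NormOneClass 𝔸] [DecidableEq ι] (hℓ : 1 ≤ ℓ) (hb₀ : 0 < b₀) (hb₁ : b₀ ≤ b₁) (M₂ : ℝ) (hM₂ : 0 ≤ M₂)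
    (hrepr : ∀ (v : 𝔸) (j : ι), |b.repr v j| ≤ M₂ * ‖v‖) :
    ∃ ρ θ M₀ T₀ : ℝ, ∃ N₀ : ℕ, 0 < ρ ∧ 0 ≤ θ ∧ ∃ a₁ : ℝ, 0 < a₁ ∧ ∃ AG : ℝ, 0 ≤ AG ∧
    ∀ (i : KIdx d ℓ hd hL b₀ b₁) (c : ↥(cubes (toKT i).D.toDomains)) (Rr : ℝ) (H : Prop),
      M₀ ≤ ((ℓ : ℝ) + 1) * (toKT i).Mh → N₀ + 1 ≤ (toKT i).R * ((ℓ + 1) * (toKT i).Mh) → T₀ ≤ RM1 i →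
    ∀ (A : AfldY 𝔸 i) (Q : Set (Site (PV d ℓ i.m i.K hd hL) 0)) (C ξ Λ : ℝ),
      0 ≤ C → 0 < ξ → 1 ≤ Λ → ξ ≤ 5 * (SC i c : ℝ) * (kGeo i).eta → LatticeNorms.scaleLen ((ℓ : ℝ) + 1) (kGeo i).eta (c.1.1 + 1) ≤ Λ * ξ →
      (∀ x : Site (PV d ℓ i.m i.K hd hL) 0, NearC i c (35 * SC i c / 8 + 1) (boxEquiv i.hN x).1 → x ∈ Q) →
      (∀ κ, ∀ x ∈ Q, ‖A κ x‖ ≤ C * ξ⁻¹) →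
      (∀ μ ν, ∀ x ∈ Q, ‖(((kGeo i).eta : ℂ)⁻¹) • covD (shiftsV1 (PV d ℓ i.m i.K hd hL)) (fun _ _ => (1 : 𝔸ˣ)) μ (A ν) x‖ ≤ C * (ξ ^ 2)⁻¹) →
      (∀ (t : ℝ) (κ : Fin (d + 1)) (x : Site (PV d ℓ i.m i.K hd hL) 0), ‖NormedSpace.exp ((I * (t : ℂ)) • A κ x)‖ ≤ 1) →
      sRead C Λ ≤ a₁ →
      IsUnit (deltaACubeY i c (parSymY i) (parBY i) (locCfgY i c (kGeo i).eta A)) ∧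
      (GVK b i c (parSymY i) (parBY i) (locCfgY i c (kGeo i).eta A) =
          GK b i c (parSymY i) (parBY i) + GK b i c (parSymY i) (parBY i) * VK b i c (parSymY i) (parBY i) (locCfgY i c (kGeo i).eta A) *
            GVK b i c (parSymY i) (parBY i) (locCfgY i c (kGeo i).eta A) ∧
        GVK b i c (parSymY i) (parBY i) (locCfgY i c (kGeo i).eta A) =
          GK b i c (parSymY i) (parBY i) + GVK b i c (parSymY i) (parBY i) (locCfgY i c (kGeo i).eta A) *
            (VK b i c (parSymY i) (parBY i) (locCfgY i c (kGeo i).eta A) * GK b i c (parSymY i) (parBY i))) ∧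
      (∀ (X : Module.End ℝ (FBondY i × ι → ℝ)) (B₀' : ℝ) (P : BlkCubeY i c → ℝ), 0 ≤ B₀' → (∀ y, 0 ≤ P y) →
        HasMajorant (g := toB6 (geoCK i c) Rr H) (blkBK i c) (X * GK b i c (parSymY i) (parBY i))
          (fun a a' => B₀' * P a * Real.exp (-(ρ * (geoCK i c).dist a a'))) →
        HasMajorant (g := toB6 (geoCK i c) Rr H) (blkBK i c) (X * GVK b i c (parSymY i) (parBY i) (locCfgY i c (kGeo i).eta A))
          (fun a a' => B₀' * θ * P a * Real.exp (-((1 - 9 / 5000) * ρ * (geoCK i c).dist a a')))) ∧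
      (HasMajorant (g := toB6 (geoCK i c) Rr H) (blkBK i c) (GK b i c (parSymY i) (parBY i))
          (fun a a' => AG * (geoCK i c).len a ^ 2 * Real.exp (-(ρ * (geoCK i c).dist a a'))) ∧
        (∀ ν : Fin (d + 1), HasMajorant (g := toB6 (geoCK i c) Rr H) (blkBK i c) (DK b i ν * GK b i c (parSymY i) (parBY i))
          (fun a a' => AG * (geoCK i c).len a * Real.exp (-(ρ * (geoCK i c).dist a a')))) ∧
        HasMajorant (g := toB6 (geoCK i c) Rr H) (blkBK i c) (LapK b i * GK b i c (parSymY i) (parBY i))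
          (fun a a' => AG * Real.exp (-(ρ * (geoCK i c).dist a a')))) ∧
      (HasMajorant (g := toB6 (geoCK i c) Rr H) (blkBK i c) (GVK b i c (parSymY i) (parBY i) (locCfgY i c (kGeo i).eta A))
          (fun a a' => AG * θ * (geoCK i c).len a ^ 2 * Real.exp (-((1 - 9 / 5000) * ρ * (geoCK i c).dist a a'))) ∧
        (∀ ν : Fin (d + 1), HasMajorant (g := toB6 (geoCK i c) Rr H) (blkBK i c) (DK b i ν * GVK b i c (parSymY i) (parBY i) (locCfgY i c (kGeo i).eta A))
          (fun a a' => AG * θ * (geoCK i c).len a * Real.exp (-((1 - 9 / 5000) * ρ * (geoCK i c).dist a a')))) ∧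
        HasMajorant (g := toB6 (geoCK i c) Rr H) (blkBK i c) (LapK b i * GVK b i c (parSymY i) (parBY i) (locCfgY i c (kGeo i).eta A))
          (fun a a' => AG * θ * 1 * Real.exp (-((1 - 9 / 5000) * ρ * (geoCK i c).dist a a')))) := by
  classical
  have h1A : ‖(1 : 𝔸)‖ ≤ 1 := norm_one.le
  have hSb : 0 ≤ ∑ j, ‖b j‖ := Finset.sum_nonneg fun j _ => norm_nonneg _
  have hMS : 0 ≤ M₂ * ∑ j, ‖b j‖ := mul_nonneg hM₂ hSb
  have hL1 : (1 : ℝ) ≤ (ℓ : ℝ) + 1 := by linarith [(Nat.cast_nonneg ℓ : (0 : ℝ) ≤ ℓ)]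
  -- G-F4: Theorem 3.3 for `G_□(1)` at `(σ₁, α = 1∕2)`, rate `δ_G = σ₁∕2`
  obtain ⟨σ₁, hσ₁, h33⟩ := thm33_GK_cube (d := d) (ℓ := ℓ) (hd := hd) (hL := hL) (𝔸 := 𝔸) b hb₀ hb₁
  obtain ⟨AG, MG, hAG, hMG, h33'⟩ := h33 σ₁ hσ₁ le_rfl (1 / 2) (by norm_num) (by norm_num)
  have hδG : 0 < delta3 (1 / 2) (2 * σ₁) := delta3_pos (by norm_num) (by positivity)
  -- G-F5c′: (3.77) for the `P₁` word at the cube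
  obtain ⟨δP, MP, TP, NP, hδP, aP, haP, K, hK, hP⟩ := cor35_POne_cube b d ℓ hℓ (Cq d) M₂ (Cq_nonneg d) hM₂ hrepr h1A
  -- one rate below both
  set δ : ℝ := min (delta3 (1 / 2) (2 * σ₁)) δP with hδdef
  have hδ : 0 < δ := lt_min hδG hδP
  have hδG' : δ ≤ delta3 (1 / 2) (2 * σ₁) := min_le_left _ _
  have hδP' : δ ≤ δP := min_le_right _ _
  set δ₀ : ℝ := δ / 2 with hδ₀def
  have hδ₀ : 0 < δ₀ := half_pos hδ
  -- (2.61) at the rate `δ₀ = ρ`, exponent `9∕5000` (p33 5a)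
  obtain ⟨dB, h261⟩ := exists_h261_geoCK d ℓ hδ₀
  have hc1 : 0 ≤ B6.c1 dB δ₀ (9 / 5000) := c1_nonneg _ _ _
  -- the constants of `cor35_G_cube_of_pieces₂`
  set cV : ℝ := (M₂ * ∑ j, ‖b j‖) * max (cV0 d) (cV1 d) * Real.exp (2 * δ) with hcVdef
  set cP : ℝ := (M₂ * ∑ j, ‖b j‖) * max (cP0 d) (cP1 d) * Real.exp (2 * δ) with hcPdef
  set κ₂ : ℝ := (M₂ * ∑ j, ‖b j‖) * (8 * ((d : ℝ) + 2) * (1 + ((d : ℝ) + 2)) * b₁ * (((ℓ + 1 : ℕ) : ℝ) ^ (d + 1)) * Real.exp (δ * (2 * (ℓ : ℝ) + 6)))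
    with hκ₂def
  have hcV00 : 0 ≤ cV0 d := by unfold cV0; positivity
  have hcP00 : 0 ≤ cP0 d := by unfold cP0; positivity
  have hcV : 0 ≤ cV := by rw [hcVdef]; exact mul_nonneg (mul_nonneg hMS (le_max_of_le_left hcV00)) (Real.exp_pos _).le
  have hcP : 0 ≤ cP := by rw [hcPdef]; exact mul_nonneg (mul_nonneg hMS (le_max_of_le_left hcP00)) (Real.exp_pos _).le
  have hb₁0 : 0 ≤ b₁ := hb₀.le.trans hb₁
  have hκ₂ : 0 ≤ κ₂ := by rw [hκ₂def]; positivity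
  set κs : ℝ := kappa385d AG (cV + cP) K κ₂ (((ℓ : ℝ) + 1) ^ 4) (B6.c1 dB δ₀ (9 / 5000)) (d + 1) * B6.c1 dB δ₀ (9 / 5000) with hκsdef
  have hκs : 0 ≤ κs := by
    rw [hκsdef]; exact mul_nonneg (kappa385d_nonneg hAG (add_nonneg hcV hcP) hK hκ₂ (by positivity) hc1) hc1
  -- the size threshold
  set a₁ : ℝ := min aP (min (1 / 6) (1 / (120 * (κs + 1)))) with ha₁def
  have ha₁ : 0 < a₁ := lt_min haP (lt_min (by norm_num) (by positivity))
  refine ⟨δ₀, 2 * B6.c1 dB δ₀ (9 / 5000), max MP MG, max TP (4 * Real.log ((ℓ : ℝ) + 1) / (9 / 5000 * δ₀)), max NP (N1 d ℓ (9 / 5000 * δ₀)), hδ₀,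
    by positivity, a₁, ha₁, AG, hAG, ?_⟩
  intro i c Rr H hM hN hT A Q C ξ Λ hC hξ hΛ hξS hΛξ hQ hA hdA hAu hsa
  -- thresholds
  have hMP : MP ≤ ((ℓ : ℝ) + 1) * (toKT i).Mh := (le_max_left _ _).trans hM
  have hMG' : MG ≤ ((ℓ : ℝ) + 1) * i.Mh := (le_max_right _ _).trans hM
  have hNP : NP + 1 ≤ (toKT i).R * ((ℓ + 1) * (toKT i).Mh) := le_trans (Nat.succ_le_succ (le_max_left _ _)) hN
  have hN1 : N1 d ℓ (9 / 5000 * δ₀) + 1 ≤ (toKT i).R * ((ℓ + 1) * (toKT i).Mh) := le_trans (Nat.succ_le_succ (le_max_right _ _)) hN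
  have hTP : TP ≤ RM1 i := (le_max_left _ _).trans hT
  have hT1 : 4 * Real.log ((ℓ : ℝ) + 1) / (9 / 5000 * δ₀) ≤ RM1 i := (le_max_right _ _).trans hT
  -- the size `s` and the window size `α_W(s)`
  set s : ℝ := sRead C Λ with hsdef
  have hs0 : 0 ≤ s := sRead_nonneg hC Λ
  have hsP : s ≤ aP := hsa.trans (min_le_left _ _)
  have hs6 : s ≤ 1 / 6 := hsa.trans ((min_le_right _ _).trans (min_le_left _ _))
  have hsκ : s ≤ 1 / (120 * (κs + 1)) := hsa.trans ((min_le_right _ _).trans (min_le_right _ _))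
  have hs4 : max C (C * (1 + D1 thetaProf)) * Λ ^ 2 ≤ 1 / 4 := by show s ≤ 1 / 4; linarith
  set αW : ℝ := alphaW s with hαWdef
  have hαW0 : 0 ≤ αW := alphaW_nonneg hs0
  have hαW60 : αW ≤ 60 * s := alphaW_le_sixty_mul hs0 hs6
  have hκs1 : 0 < κs + 1 := by linarith
  have hαWκ : αW * (κs + 1) ≤ 1 / 2 := by
    calc αW * (κs + 1) ≤ 60 * s * (κs + 1) := mul_le_mul_of_nonneg_right hαW60 hκs1.le
      _ ≤ 60 * (1 / (120 * (κs + 1))) * (κs + 1) := by gcongr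
      _ = 1 / 2 := by field_simp; ring
  have hαW1 : αW ≤ 1 := by nlinarith
  have hsmall : kappa385d AG (cV + cP) K κ₂ (((ℓ : ℝ) + 1) ^ 4) (B6.c1 dB δ₀ (9 / 5000)) (d + 1) * αW * B6.c1 dB δ₀ (9 / 5000) < 1 := by
    have : kappa385d AG (cV + cP) K κ₂ (((ℓ : ℝ) + 1) ^ 4) (B6.c1 dB δ₀ (9 / 5000)) (d + 1) * αW * B6.c1 dB δ₀ (9 / 5000) = κs * αW := by
      rw [hκsdef]; ring
    rw [this]; nlinarith
  have hinv2 : (1 - kappa385d AG (cV + cP) K κ₂ (((ℓ : ℝ) + 1) ^ 4) (B6.c1 dB δ₀ (9 / 5000)) (d + 1) * αW * B6.c1 dB δ₀ (9 / 5000))⁻¹ ≤ 2 := by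
    have e : kappa385d AG (cV + cP) K κ₂ (((ℓ : ℝ) + 1) ^ 4) (B6.c1 dB δ₀ (9 / 5000)) (d + 1) * αW * B6.c1 dB δ₀ (9 / 5000) = κs * αW := by
      rw [hκsdef]; ring
    rw [e]
    have h12 : 1 / 2 ≤ 1 - κs * αW := by nlinarith
    calc (1 - κs * αW)⁻¹ ≤ (1 / 2)⁻¹ := inv_anti₀ (by norm_num) h12
      _ = 2 := by norm_num
  -- geometry
  haveI : Nonempty (geoCK i c).Site := B9CubeGeometryInputs.geoCK_site_nonempty i c
  obtain ⟨hdnn, -, -, -⟩ := geoCK_dist_axioms i c Rr H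
  set η : ℝ := (kGeo i).eta with hηdef
  have hη : 0 < η := by rw [hηdef, ← geoCK_eta i c]; exact geoCK_eta_pos i c
  have hparS : ∀ z w : SiteY i, parSymY i (fun _ _ => (1 : 𝔸ˣ)) z w = 1 := fun z w => parSymY_one i z w
  have hparB : ∀ s s', parBY (𝔸 := 𝔸) i (fun _ _ => 1) s s' = 1 := fun s s' => parBY_one i s s'
  have hU := unitaryLike_locCfgY i c hAu (kGeo i).eta
  -- SLOT hG ∕ hDG: G-F4 at the rate `δ`
  obtain ⟨gG, gDG, gLG⟩ := h33' i c Rr H (parSymY i) (parBY i) hparS hparB hMG'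
  have hG : HasMajorant (g := toB6 (geoCK i c) Rr H) (blkBK i c) (GK b i c (parSymY i) (parBY i))
      (fun a a' => AG * (geoCK i c).len a ^ 2 * Real.exp (-(δ * (geoCK i c).dist a a'))) :=
    hasMajorant_mono (g := toB6 (geoCK i c) Rr H) _ gG fun a a' => kernel_rate_mono hdnn hδG' (mul_nonneg hAG (sq_nonneg _)) a a'
  have hDG : ∀ ν, HasMajorant (g := toB6 (geoCK i c) Rr H) (blkBK i c) (DK b i ν * GK b i c (parSymY i) (parBY i))
      (fun a a' => AG * (geoCK i c).len a * Real.exp (-(δ * (geoCK i c).dist a a'))) := fun ν =>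
    hasMajorant_mono (g := toB6 (geoCK i c) Rr H) _ (gDG ν) fun a a' => kernel_rate_mono hdnn hδG' (mul_nonneg hAG (geoCK_len_pos i c a).le) a a'
  -- (v1.1) the three flat entries at the transfer rate `δ₀ = δ∕2 ≤ δ`
  have hδ₀δ : δ₀ ≤ δ := by rw [hδ₀def]; linarith
  have hGρ : HasMajorant (g := toB6 (geoCK i c) Rr H) (blkBK i c) (GK b i c (parSymY i) (parBY i))
      (fun a a' => AG * (geoCK i c).len a ^ 2 * Real.exp (-(δ₀ * (geoCK i c).dist a a'))) :=
    hasMajorant_mono (g := toB6 (geoCK i c) Rr H) _ hG fun a a' => kernel_rate_mono hdnn hδ₀δ (mul_nonneg hAG (sq_nonneg _)) a a'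
  have hDGρ : ∀ ν, HasMajorant (g := toB6 (geoCK i c) Rr H) (blkBK i c) (DK b i ν * GK b i c (parSymY i) (parBY i))
      (fun a a' => AG * (geoCK i c).len a * Real.exp (-(δ₀ * (geoCK i c).dist a a'))) := fun ν =>
    hasMajorant_mono (g := toB6 (geoCK i c) Rr H) _ (hDG ν) fun a a' => kernel_rate_mono hdnn hδ₀δ (mul_nonneg hAG (geoCK_len_pos i c a).le) a a'
  have hLGρ : HasMajorant (g := toB6 (geoCK i c) Rr H) (blkBK i c) (LapK b i * GK b i c (parSymY i) (parBY i))
      (fun a a' => AG * Real.exp (-(δ₀ * (geoCK i c).dist a a'))) :=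
    hasMajorant_mono (g := toB6 (geoCK i c) Rr H) _ gLG fun a a' => kernel_rate_mono hdnn (hδ₀δ.trans hδG') hAG a a'
  -- SLOT hLap ∕ hV0 ∕ hV1: G-F5a + bridge II
  have hLap : lapPieceK b i (locCfgY i c (kGeo i).eta A) =
      conj b ((B9Eq371CoCurlLeibnizY.V0Y i (locCfgY i c (kGeo i).eta A)).restrictScalars ℝ) +
        ∑ μ, conj b ((B9Eq371CoCurlLeibnizY.V1Y i (locCfgY i c (kGeo i).eta A) μ).restrictScalars ℝ) * DK b i μ :=
    conj_hessY_one_sub_hessY_eq i b _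
  have hV0 := hasMajorant_V0Y_locCfgY b i c hC hξ hΛ hξS hΛξ hQ hA hdA hAu hM₂ hrepr hαW1 hδ.le Rr H
  have hV1 := hasMajorant_V1Y_locCfgY b i c hC hξ hΛ hξS hΛξ hQ hA hdA hAu hM₂ hrepr hδ.le Rr H
  have hV0' : HasMajorant (g := toB6 (geoCK i c) Rr H) (blkBK i c) (conj b ((B9Eq371CoCurlLeibnizY.V0Y i (locCfgY i c (kGeo i).eta A)).restrictScalars ℝ))
      (fun a a' => cV * αW * ((geoCK i c).len a ^ 2)⁻¹ * Real.exp (-(δ * (geoCK i c).dist a a'))) := by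
    refine hasMajorant_mono (g := toB6 (geoCK i c) Rr H) _ hV0 fun a a' => ?_
    have hw : 0 ≤ αW * ((geoCK i c).len a ^ 2)⁻¹ * Real.exp (-(δ * (geoCK i c).dist a a')) := by positivity
    have hle : (M₂ * ∑ j, ‖b j‖) * (cV0 d * Real.exp (2 * δ)) ≤ cV := by
      rw [hcVdef, mul_assoc (M₂ * ∑ j, ‖b j‖)]; exact mul_le_mul_of_nonneg_left (mul_le_mul_of_nonneg_right (le_max_left _ _) (Real.exp_pos _).le) hMS
    calc (M₂ * ∑ j, ‖b j‖) * (cV0 d * Real.exp (2 * δ) * αW * ((geoCK i c).len a ^ 2)⁻¹ * Real.exp (-(δ * (geoCK i c).dist a a')))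
        = (M₂ * ∑ j, ‖b j‖) * (cV0 d * Real.exp (2 * δ)) * (αW * ((geoCK i c).len a ^ 2)⁻¹ * Real.exp (-(δ * (geoCK i c).dist a a'))) := by ring
      _ ≤ cV * (αW * ((geoCK i c).len a ^ 2)⁻¹ * Real.exp (-(δ * (geoCK i c).dist a a'))) := mul_le_mul_of_nonneg_right hle hw
      _ = cV * αW * ((geoCK i c).len a ^ 2)⁻¹ * Real.exp (-(δ * (geoCK i c).dist a a')) := by ring
  have hV1' : ∀ ν, HasMajorant (g := toB6 (geoCK i c) Rr H) (blkBK i c)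
      (conj b ((B9Eq371CoCurlLeibnizY.V1Y i (locCfgY i c (kGeo i).eta A) ν).restrictScalars ℝ))
      (fun a a' => cV * αW * ((geoCK i c).len a)⁻¹ * Real.exp (-(δ * (geoCK i c).dist a a'))) := fun ν => by
    refine hasMajorant_mono (g := toB6 (geoCK i c) Rr H) _ (hV1 ν) fun a a' => ?_
    have hl : 0 ≤ ((geoCK i c).len a)⁻¹ := inv_nonneg.2 (geoCK_len_pos i c a).le
    have hw : 0 ≤ αW * ((geoCK i c).len a)⁻¹ * Real.exp (-(δ * (geoCK i c).dist a a')) := by positivity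
    have hle : (M₂ * ∑ j, ‖b j‖) * (cV1 d * Real.exp (2 * δ)) ≤ cV := by
      rw [hcVdef, mul_assoc (M₂ * ∑ j, ‖b j‖)]; exact mul_le_mul_of_nonneg_left (mul_le_mul_of_nonneg_right (le_max_right _ _) (Real.exp_pos _).le) hMS
    calc (M₂ * ∑ j, ‖b j‖) * (cV1 d * Real.exp (2 * δ) * αW * ((geoCK i c).len a)⁻¹ * Real.exp (-(δ * (geoCK i c).dist a a')))
        = (M₂ * ∑ j, ‖b j‖) * (cV1 d * Real.exp (2 * δ)) * (αW * ((geoCK i c).len a)⁻¹ * Real.exp (-(δ * (geoCK i c).dist a a'))) := by ring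
      _ ≤ cV * (αW * ((geoCK i c).len a)⁻¹ * Real.exp (-(δ * (geoCK i c).dist a a'))) := mul_le_mul_of_nonneg_right hle hw
      _ = cV * αW * ((geoCK i c).len a)⁻¹ * Real.exp (-(δ * (geoCK i c).dist a a')) := by ring
  -- SLOT hProj ∕ hP0 ∕ hP1: G-F5c″ split + G-F5b at bridge II's windows
  have hProj := projPieceK_eq_firstOrder_add_projWord b i c (parSymY i) (locCfgY i c (kGeo i).eta A)
  have hW1 := hW1_locCfgY i c hC hξ hΛ hξS hQ hA hdA hΛξ
  have hW2 := hW2_locCfgY i c hC hξ hΛ hξS hQ hA hdA hΛξ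
  have hP0 := hasMajorant_P0Y i c b hU hM₂ hrepr hαW0 hαW1 hW1 hW2 hδ.le Rr H
  have hP1 := fun ν => hasMajorant_P1Y i c b hU hM₂ hrepr hαW0 hW1 hδ.le Rr H ν
  have hP0' : HasMajorant (g := toB6 (geoCK i c) Rr H) (blkBK i c)
      (conj b ((B9Eq375GradDivSplitY.P0Y i (locCfgY i c (kGeo i).eta A)).restrictScalars ℝ))
      (fun a a' => cP * αW * ((geoCK i c).len a ^ 2)⁻¹ * Real.exp (-(δ * (geoCK i c).dist a a'))) := by
    refine hasMajorant_mono (g := toB6 (geoCK i c) Rr H) _ hP0 fun a a' => ?_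
    have hw : 0 ≤ αW * ((geoCK i c).len a ^ 2)⁻¹ * Real.exp (-(δ * (geoCK i c).dist a a')) := by positivity
    have hle : (M₂ * ∑ j, ‖b j‖) * (cP0 d * Real.exp (2 * δ)) ≤ cP := by
      rw [hcPdef, mul_assoc (M₂ * ∑ j, ‖b j‖)]; exact mul_le_mul_of_nonneg_left (mul_le_mul_of_nonneg_right (le_max_left _ _) (Real.exp_pos _).le) hMS
    calc (M₂ * ∑ j, ‖b j‖) * (cP0 d * Real.exp (2 * δ) * αW * ((geoCK i c).len a ^ 2)⁻¹ * Real.exp (-(δ * (geoCK i c).dist a a')))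
        = (M₂ * ∑ j, ‖b j‖) * (cP0 d * Real.exp (2 * δ)) * (αW * ((geoCK i c).len a ^ 2)⁻¹ * Real.exp (-(δ * (geoCK i c).dist a a'))) := by ring
      _ ≤ cP * (αW * ((geoCK i c).len a ^ 2)⁻¹ * Real.exp (-(δ * (geoCK i c).dist a a'))) := mul_le_mul_of_nonneg_right hle hw
      _ = cP * αW * ((geoCK i c).len a ^ 2)⁻¹ * Real.exp (-(δ * (geoCK i c).dist a a')) := by ring
  have hP1' : ∀ ν, HasMajorant (g := toB6 (geoCK i c) Rr H) (blkBK i c)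
      (conj b ((B9Eq375GradDivSplitY.P1Y i (locCfgY i c (kGeo i).eta A) ν).restrictScalars ℝ))
      (fun a a' => cP * αW * ((geoCK i c).len a)⁻¹ * Real.exp (-(δ * (geoCK i c).dist a a'))) := fun ν => by
    refine hasMajorant_mono (g := toB6 (geoCK i c) Rr H) _ (hP1 ν) fun a a' => ?_
    have hl : 0 ≤ ((geoCK i c).len a)⁻¹ := inv_nonneg.2 (geoCK_len_pos i c a).le
    have hw : 0 ≤ αW * ((geoCK i c).len a)⁻¹ * Real.exp (-(δ * (geoCK i c).dist a a')) := by positivity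
    have hle : (M₂ * ∑ j, ‖b j‖) * (cP1 d * Real.exp (2 * δ)) ≤ cP := by
      rw [hcPdef, mul_assoc (M₂ * ∑ j, ‖b j‖)]; exact mul_le_mul_of_nonneg_left (mul_le_mul_of_nonneg_right (le_max_right _ _) (Real.exp_pos _).le) hMS
    calc (M₂ * ∑ j, ‖b j‖) * (cP1 d * Real.exp (2 * δ) * αW * ((geoCK i c).len a)⁻¹ * Real.exp (-(δ * (geoCK i c).dist a a')))
        = (M₂ * ∑ j, ‖b j‖) * (cP1 d * Real.exp (2 * δ)) * (αW * ((geoCK i c).len a)⁻¹ * Real.exp (-(δ * (geoCK i c).dist a a'))) := by ring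
      _ ≤ cP * (αW * ((geoCK i c).len a)⁻¹ * Real.exp (-(δ * (geoCK i c).dist a a'))) := mul_le_mul_of_nonneg_right hle hw
      _ = cP * αW * ((geoCK i c).len a)⁻¹ * Real.exp (-(δ * (geoCK i c).dist a a')) := by ring
  -- SLOT hPP: G-F5c′ at the datum (the nine readings as in p21's `cinv_cube_at_locCfg`) + G-F5c″
  have hlenS : ∀ z : SiteY i, (geoCK i c).len (blkCubeY i c z) = LatticeNorms.scaleLen ((ℓ : ℝ) + 1) η (levCubeY i c z) := fun z => by
    rw [(geoCK_len_blkCubeY i c z).1]; rfl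
  have hlen : ∀ z : SiteY i, 0 < (geoCK i c).len (blkCubeY i c z) := fun z => by
    rw [hlenS]; exact (scaleLen_levCubeY_bounds i c hL1 hη hΛξ z).1
  have hlenΛ : ∀ z : SiteY i, (geoCK i c).len (blkCubeY i c z) ≤ Λ * ξ := fun z => by
    rw [hlenS]; exact (scaleLen_levCubeY_bounds i c hL1 hη hΛξ z).2
  obtain ⟨r1, r2, r3, r4, r5⟩ := readings337_locFld i c hC hη hξ hΛ hξS hQ hA hdA (fun z => (geoCK i c).len (blkCubeY i c z)) hlen hlenΛ
  have hG1 : ∀ u : 𝔸ˣ, u ∈ (⊥ : Subgroup 𝔸ˣ) → ‖(u : 𝔸)‖ ≤ 1 := fun u hu => by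
    rw [Subgroup.mem_bot] at hu; rw [hu, Units.val_one]; exact h1A
  have hU1 : ∀ (μ : Fin (d + 1)) (x : Site (PV d ℓ i.m i.K hd hL) 0), ((fun _ _ => (1 : 𝔸ˣ)) : CfgY 𝔸 i) μ x ∈ (⊥ : Subgroup 𝔸ˣ) :=
    fun _ _ => Subgroup.one_mem _
  have hown := ownLevel_of_blockwise i c hη (cutFldY i (chiTY i c) A) (α₁ := s) (fun k x => by
    have h := r4 k x
    rw [(geoCK_len_blkCubeY i c x).1, levCubeY_eq] at h
    push_cast
    exact h)
  have hkF : ∀ (y : BlkCubeY i c) (x : SiteY i), blkCubeY i c x = y →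
      ‖kFCubeY i c (parSymY i) (fun _ _ => 1) (locCfgY i c η A) y x‖ ≤ Cq d * s * wK i c y :=
    fun y x hx => norm_kFCubeY_parSymY_le i c ⊥ hG1 hU1 hη.le (cutFldY i (chiTY i c) A) y hs0 hs4 (hown y) x hx
  have hsF : ∀ x : SiteY i, ‖sFCubeY i c (parSymY i) (fun _ _ => 1) (locCfgY i c η A) x‖ ≤ Cq d * s :=
    fun x => norm_sFCubeY_parSymY_le i c ⊥ hG1 hU1 hη.le (cutFldY i (chiTY i c) A) x hs0 hs4 (hown (blkCubeY i c x))
  have hF : ∀ (s' : BlkCubeY i c) (lam : SiteY i → 𝔸),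
      ‖(QpCubeY i c (parSymY i) (locCfgY i c η A) lam - QpCubeY i c (parSymY i) (fun _ _ => 1) lam) s'‖ ≤ Cq d * s * ∑ z, |qpKc i c s' z| * ‖lam z‖ :=
    fun s' lam => norm_QpCubeY_prod_sub_apply_le i c ⊥ hG1 hU1 hη.le (cutFldY i (chiTY i c) A) s' hs0 hs4 (hown s') lam
  have hFs : ∀ (z : SiteY i) (nu : BlkCubeY i c → 𝔸),
      ‖(QpsCubeY i c (parSymY i) (locCfgY i c η A) nu - QpsCubeY i c (parSymY i) (fun _ _ => 1) nu) z‖ ≤ Cq d * s * ∑ s', |qpsKc i c z s'| * ‖nu s'‖ :=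
    fun z nu => norm_QpsCubeY_prod_sub_apply_le i c ⊥ hG1 hU1 hη.le (cutFldY i (chiTY i c) A) z hs0 hs4 (hown (blkCubeY i c z)) nu
  have hPO := hP i c Rr H (parSymY i) hparS hMP hNP hTP s hs0 hsP A hkF hsF
    (fun ν k x => by rw [geoCK_eta]; exact r1 ν k x) (fun μ ν x => by rw [geoCK_eta]; exact r2 μ ν x)
    (fun μ x => by rw [geoCK_eta]; exact r3 μ x) r4 r5 hF hFs
  have hPP0 := hasMajorant_projWord_of_POne b i c (parSymY i) Rr H (locCfgY i c (kGeo i).eta A) hPO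
  have hPP : HasMajorant (g := toB6 (geoCK i c) Rr H) (blkBK i c)
      (conj b ((Node00.gradY i (locCfgY i c (kGeo i).eta A) ∘ₗ
          (GpCubeY i c (parSymY i) (locCfgY i c (kGeo i).eta A) ∘ₗ QpsCubeY i c (parSymY i) (locCfgY i c (kGeo i).eta A) ∘ₗ
            XinvCubeY i c (parSymY i) (locCfgY i c (kGeo i).eta A) ∘ₗ QpCubeY i c (parSymY i) (locCfgY i c (kGeo i).eta A) ∘ₗ
            GpCubeY i c (parSymY i) (locCfgY i c (kGeo i).eta A)) ∘ₗ Node00.divY i (locCfgY i c (kGeo i).eta A) -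
        Node00.gradY i (fun _ _ => 1) ∘ₗ (GpCubeY i c (parSymY i) (fun _ _ => 1) ∘ₗ QpsCubeY i c (parSymY i) (fun _ _ => 1) ∘ₗ
          XinvCubeY i c (parSymY i) (fun _ _ => 1) ∘ₗ QpCubeY i c (parSymY i) (fun _ _ => 1) ∘ₗ GpCubeY i c (parSymY i) (fun _ _ => 1)) ∘ₗ
          Node00.divY i (fun _ _ => 1)).restrictScalars ℝ))
      (fun a a' => K * αW * ((geoCK i c).len a ^ 2)⁻¹ * Real.exp (-(δ * (geoCK i c).dist a a'))) := by
    refine hasMajorant_mono (g := toB6 (geoCK i c) Rr H) _ hPP0 fun a a' => ?_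
    have hl : 0 ≤ ((geoCK i c).len a ^ 2)⁻¹ := by positivity
    calc K * s * ((geoCK i c).len a ^ 2)⁻¹ * Real.exp (-(δP * (geoCK i c).dist a a'))
        = (K * s) * ((geoCK i c).len a ^ 2)⁻¹ * Real.exp (-(δP * (geoCK i c).dist a a')) := by ring
      _ ≤ (K * αW) * ((geoCK i c).len a ^ 2)⁻¹ * Real.exp (-(δ * (geoCK i c).dist a a')) :=
          kernel_const_mono hdnn (fun a => ((geoCK i c).len a ^ 2)⁻¹) (fun a => by positivity) (mul_le_mul_of_nonneg_left (self_le_alphaW hs0) hK)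
            (mul_nonneg hK hαW0) hδP' a a'
      _ = K * αW * ((geoCK i c).len a ^ 2)⁻¹ * Real.exp (-(δ * (geoCK i c).dist a a')) := by ring
  -- SLOT hAv: bridge II
  have hAv0 := hasMajorant_avgPieceK_locCfgY b i c hC hξ hΛ hξS hΛξ hQ hA hdA hAu hM₂ hrepr hb₀ hb₁ hδ.le Rr H
  have hAv : HasMajorant (g := toB6 (geoCK i c) Rr H) (blkBK i c) (avgPieceK b i c (locCfgY i c (kGeo i).eta A))
      (fun a a' => κ₂ * αW * ((geoCK i c).len a ^ 2)⁻¹ * Real.exp (-(δ * (geoCK i c).dist a a'))) := by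
    refine hasMajorant_mono (g := toB6 (geoCK i c) Rr H) _ hAv0 fun a a' => ?_
    have hw : 0 ≤ ((geoCK i c).len a ^ 2)⁻¹ * Real.exp (-(δ * (geoCK i c).dist a a')) := by positivity
    have hk := kappaAv_le_of_le_one d ℓ (δ := δ) hb₁0 hαW0 hαW1
    calc (M₂ * ∑ j, ‖b j‖) * (kappaAv d ℓ b₁ αW δ * ((geoCK i c).len a ^ 2)⁻¹ * Real.exp (-(δ * (geoCK i c).dist a a')))
        = (M₂ * ∑ j, ‖b j‖) * kappaAv d ℓ b₁ αW δ * (((geoCK i c).len a ^ 2)⁻¹ * Real.exp (-(δ * (geoCK i c).dist a a'))) := by ring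
      _ ≤ (M₂ * ∑ j, ‖b j‖) * (αW * (8 * ((d : ℝ) + 2) * (1 + ((d : ℝ) + 2)) * b₁ * (((ℓ + 1 : ℕ) : ℝ) ^ (d + 1)) * Real.exp (δ * (2 * (ℓ : ℝ) + 6)))) *
            (((geoCK i c).len a ^ 2)⁻¹ * Real.exp (-(δ * (geoCK i c).dist a a'))) :=
          mul_le_mul_of_nonneg_right (mul_le_mul_of_nonneg_left hk hMS) hw
      _ = κ₂ * αW * ((geoCK i c).len a ^ 2)⁻¹ * Real.exp (-(δ * (geoCK i c).dist a a')) := by rw [hκ₂def]; ring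
  -- (2.61) twice (same exponent, `ρ = δ₀`), the two scale transfers
  have h261' : Ineq261 dB (toB6 (geoCK i c) Rr H) δ₀ (9 / 5000) := h261 i c Rr H hN1 (9 / 5000) le_rfl (by norm_num)
  obtain ⟨hST1, hST2, -⟩ := hST_geoCK i c hδ₀ hT1 (9 / 5000) le_rfl
  -- G-F5′
  obtain ⟨hunit, hlaws, htr⟩ := cor35_G_cube_of_pieces₂ b i c (parSymY i) hb₀ hparS Rr H dB dB δ₀ δ (9 / 5000) (9 / 5000) δ₀ (9 / 5000)
    (((ℓ : ℝ) + 1) ^ 4) AG cV cP K κ₂ αW hAG hcV hcP hK hκ₂ hαW0 (by positivity) hδ₀.le (by norm_num) (by norm_num) hδ₀.le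
    (by rw [hδ₀def]; nlinarith) (by norm_num) (by positivity) h261' h261' hST1 hST2 hsmall (locCfgY i c (kGeo i).eta A) hG hDG hLap hV0' hV1' hProj hP0' hP1'
    hPP hAv
  have htr' : ∀ (X : Module.End ℝ (FBondY i × ι → ℝ)) (B₀' : ℝ) (P : BlkCubeY i c → ℝ), 0 ≤ B₀' → (∀ y, 0 ≤ P y) →
      HasMajorant (g := toB6 (geoCK i c) Rr H) (blkBK i c) (X * GK b i c (parSymY i) (parBY i))
        (fun a a' => B₀' * P a * Real.exp (-(δ₀ * (geoCK i c).dist a a'))) →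
      HasMajorant (g := toB6 (geoCK i c) Rr H) (blkBK i c) (X * GVK b i c (parSymY i) (parBY i) (locCfgY i c (kGeo i).eta A))
        (fun a a' => B₀' * (2 * B6.c1 dB δ₀ (9 / 5000)) * P a * Real.exp (-((1 - 9 / 5000) * δ₀ * (geoCK i c).dist a a'))) := by
    intro X B₀' P hB₀' hP hX
    refine hasMajorant_mono (g := toB6 (geoCK i c) Rr H) _ (htr X B₀' P hB₀' hP hX) fun a a' => ?_
    have hw : 0 ≤ P a * Real.exp (-((1 - 9 / 5000) * δ₀ * (geoCK i c).dist a a')) := mul_nonneg (hP a) (Real.exp_pos _).le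
    calc B₀' * B6.c1 dB δ₀ (9 / 5000) *
          (1 - kappa385d AG (cV + cP) K κ₂ (((ℓ : ℝ) + 1) ^ 4) (B6.c1 dB δ₀ (9 / 5000)) (d + 1) * αW * B6.c1 dB δ₀ (9 / 5000))⁻¹ * P a *
          Real.exp (-((1 - 9 / 5000) * δ₀ * (geoCK i c).dist a a'))
        = B₀' * (B6.c1 dB δ₀ (9 / 5000) *
            (1 - kappa385d AG (cV + cP) K κ₂ (((ℓ : ℝ) + 1) ^ 4) (B6.c1 dB δ₀ (9 / 5000)) (d + 1) * αW * B6.c1 dB δ₀ (9 / 5000))⁻¹) *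
            (P a * Real.exp (-((1 - 9 / 5000) * δ₀ * (geoCK i c).dist a a'))) := by ring
      _ ≤ B₀' * (B6.c1 dB δ₀ (9 / 5000) * 2) * (P a * Real.exp (-((1 - 9 / 5000) * δ₀ * (geoCK i c).dist a a'))) := by gcongr
      _ = B₀' * (2 * B6.c1 dB δ₀ (9 / 5000)) * P a * Real.exp (-((1 - 9 / 5000) * δ₀ * (geoCK i c).dist a a')) := by ring
  -- (v1.1) the three transferred left entries: `X := 1`, `X := DK ν`, `X := LapK`
  have hlen0 : ∀ y : BlkCubeY i c, 0 ≤ (geoCK i c).len y := fun y => (geoCK_len_pos i c y).le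
  have t0 := htr' 1 AG (fun a => (geoCK i c).len a ^ 2) hAG (fun _ => sq_nonneg _) (by rw [one_mul]; exact hGρ)
  rw [one_mul] at t0
  have t1 := fun ν => htr' (DK b i ν) AG (fun a => (geoCK i c).len a) hAG hlen0 (hDGρ ν)
  have t3 := htr' (LapK b i) AG (fun _ => (1 : ℝ)) hAG (fun _ => zero_le_one) (by
    refine hasMajorant_mono (g := toB6 (geoCK i c) Rr H) _ hLGρ fun a a' => le_of_eq ?_
    rw [mul_one])
  exact ⟨hunit, hlaws, htr', ⟨hGρ, hDGρ, hLGρ⟩, ⟨t0, t1, t3⟩⟩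

/-- ★★★ **COROLLARY 3.6 FOR THE BOND-SECTOR CUBE LETTER `G_□ = Δ_{a,□}⁻¹` AT THE LOCALISED FIELD `Ṽ_□ = e^{iηχ̃_□A}`, UNIFORMLY IN THE MEMBER AND THE COVER CUBE** (the v1.0
statement, verbatim; now the projection of `cor36_G_cube_at_locCfg'`): there are a rate `ρ > 0`, a constant `θ ≧ 0`, member thresholds `M₀, T₀, N₀` and a size threshold `a₁ > 0`
— functions of `d, L, b₀, b₁` and the basis datum `M₂` only — such that for every member above the thresholds, every cover cube `□` and every vector potential `A` of Hermitian
type carrying the (3.35) cube datum `(Q, C, ξ, Λ)` with `max(C, C(1+D₁θ))Λ² ≦ a₁`: `Δ_{a,□}(Ṽ_□)` (transporters `parSymY`, `parBY`) IS A UNIT, the two (3.86) resolvent laws hold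
for the realified `G_□(Ṽ_□) = conj b(Δ_{a,□}(Ṽ_□)⁻¹)`, and every LEFT (3.42) entry transfers: `X·G_□(1) ≺ B·P(a)·e^{−ρd}` ⟹ `X·G_□(Ṽ_□) ≺ B·θ·P(a)·e^{−(1 − 9∕5000)ρ·d}`
over `(toB6 (geoCK i □) Rr H, blkBK i □)`.
[cite: Balaban1985BackgroundPropagators, Cor. 3.6 p.408, Thm 3.4 p.400, (3.82)–(3.86) p.407, (3.69)–(3.77) pp.404–406, Cor. 3.5 p.407, p.409 l.1–5; Balaban1984PropagatorsII, Lemma 2.1 (2.61) p.234, (2.51) p.232] -/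
theorem cor36_G_cube_at_locCfg [NormOneClass 𝔸] [DecidableEq ι] (hℓ : 1 ≤ ℓ) (hb₀ : 0 < b₀) (hb₁ : b₀ ≤ b₁) (M₂ : ℝ) (hM₂ : 0 ≤ M₂)
    (hrepr : ∀ (v : 𝔸) (j : ι), |b.repr v j| ≤ M₂ * ‖v‖) :
    ∃ ρ θ M₀ T₀ : ℝ, ∃ N₀ : ℕ, 0 < ρ ∧ 0 ≤ θ ∧ ∃ a₁ : ℝ, 0 < a₁ ∧
    ∀ (i : KIdx d ℓ hd hL b₀ b₁) (c : ↥(cubes (toKT i).D.toDomains)) (Rr : ℝ) (H : Prop),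
      M₀ ≤ ((ℓ : ℝ) + 1) * (toKT i).Mh → N₀ + 1 ≤ (toKT i).R * ((ℓ + 1) * (toKT i).Mh) → T₀ ≤ RM1 i →
    ∀ (A : AfldY 𝔸 i) (Q : Set (Site (PV d ℓ i.m i.K hd hL) 0)) (C ξ Λ : ℝ),
      0 ≤ C → 0 < ξ → 1 ≤ Λ → ξ ≤ 5 * (SC i c : ℝ) * (kGeo i).eta → LatticeNorms.scaleLen ((ℓ : ℝ) + 1) (kGeo i).eta (c.1.1 + 1) ≤ Λ * ξ →
      (∀ x : Site (PV d ℓ i.m i.K hd hL) 0, NearC i c (35 * SC i c / 8 + 1) (boxEquiv i.hN x).1 → x ∈ Q) →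
      (∀ κ, ∀ x ∈ Q, ‖A κ x‖ ≤ C * ξ⁻¹) →
      (∀ μ ν, ∀ x ∈ Q, ‖(((kGeo i).eta : ℂ)⁻¹) • covD (shiftsV1 (PV d ℓ i.m i.K hd hL)) (fun _ _ => (1 : 𝔸ˣ)) μ (A ν) x‖ ≤ C * (ξ ^ 2)⁻¹) →
      (∀ (t : ℝ) (κ : Fin (d + 1)) (x : Site (PV d ℓ i.m i.K hd hL) 0), ‖NormedSpace.exp ((I * (t : ℂ)) • A κ x)‖ ≤ 1) →
      sRead C Λ ≤ a₁ →
      IsUnit (deltaACubeY i c (parSymY i) (parBY i) (locCfgY i c (kGeo i).eta A)) ∧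
      (GVK b i c (parSymY i) (parBY i) (locCfgY i c (kGeo i).eta A) =
          GK b i c (parSymY i) (parBY i) + GK b i c (parSymY i) (parBY i) * VK b i c (parSymY i) (parBY i) (locCfgY i c (kGeo i).eta A) *
            GVK b i c (parSymY i) (parBY i) (locCfgY i c (kGeo i).eta A) ∧
        GVK b i c (parSymY i) (parBY i) (locCfgY i c (kGeo i).eta A) =
          GK b i c (parSymY i) (parBY i) + GVK b i c (parSymY i) (parBY i) (locCfgY i c (kGeo i).eta A) *
            (VK b i c (parSymY i) (parBY i) (locCfgY i c (kGeo i).eta A) * GK b i c (parSymY i) (parBY i))) ∧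
      ∀ (X : Module.End ℝ (FBondY i × ι → ℝ)) (B₀' : ℝ) (P : BlkCubeY i c → ℝ), 0 ≤ B₀' → (∀ y, 0 ≤ P y) →
        HasMajorant (g := toB6 (geoCK i c) Rr H) (blkBK i c) (X * GK b i c (parSymY i) (parBY i))
          (fun a a' => B₀' * P a * Real.exp (-(ρ * (geoCK i c).dist a a'))) →
        HasMajorant (g := toB6 (geoCK i c) Rr H) (blkBK i c) (X * GVK b i c (parSymY i) (parBY i) (locCfgY i c (kGeo i).eta A))
          (fun a a' => B₀' * θ * P a * Real.exp (-((1 - 9 / 5000) * ρ * (geoCK i c).dist a a'))) := by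
  obtain ⟨ρ, θ, M₀, T₀, N₀, hρ, hθ, a₁, ha₁, AG, -, h⟩ := cor36_G_cube_at_locCfg' b hℓ hb₀ hb₁ M₂ hM₂ hrepr
  refine ⟨ρ, θ, M₀, T₀, N₀, hρ, hθ, a₁, ha₁, fun i c Rr H hM hN hT A Q C ξ Λ hC hξ hΛ hξS hΛξ hQ hA hdA hAu hsa => ?_⟩
  obtain ⟨hunit, hlaws, htr, -, -⟩ := h i c Rr H hM hN hT A Q C ξ Λ hC hξ hΛ hξS hΛξ hQ hA hdA hAu hsa
  exact ⟨hunit, hlaws, htr⟩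

end Main

end Literature.MathematicalPhysics.QuantumFieldTheory.Balaban1983to89.B9Cor36GCubeAtLocCfg

end
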